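import Summits.BirchSwinnertonDyer.BirchSwinnertonDyer.Theorems.Rank2ObservatoryCubicFieldR257876
import HarnessLib

/-!
# BirchSwinnertonDyer — rank ≥ 2 observatory: class number one of the cubic field of `-394 + 546 * X - 46 * X ^ 2 + X ^ 3` (`Δ = 257876`) — certificates at the primes 131, 137, 139

HONEST FRAMING: per-curve certified theorems and census instruments; no claim on BSD in rank ≥ 2.

Companion of the per-FIELD file `Rank2ObservatoryCubicFieldR257876` of the KERNEL-2DESC instrument (design
`b2b-bsdr2-cert-3/KERNEL-2DESC.md` §9e–§9g): the degree-one prime-element certificates at the primes 131, 137, 139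
(part b). Split off for file size; generated by the same generator from the same checked data.
Sorry-free; axioms `propext`, `Classical.choice`, `Quot.sound`.
[cite: Marcus2018, Ch. 3 Thm. 27, Ch. 5 Cor. 2 of Thm. 37]
-/

-- single-conjunct summit: `Summit.BirchSwinnertonDyer.BirchSwinnertonDyer.…` repeats the name by design
set_option linter.dupNamespace false

noncomputable section

open scoped Classical NumberField

open Literature.NumberTheory.NumberFields Polynomial Module NumberField

namespace Summit.BirchSwinnertonDyer.BirchSwinnertonDyer.Rank2Observatory.TwoDescCubic

namespace FieldR257876

/-! ## Class number one -/

/-- Certificate at `131`: every ring map `ψ : 𝓞 K → ℤ/131` kills a prime element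
(`α ↦ 25`: `-25 + α` (norm `-131`)). [cite: Marcus2018, Ch. 3, Thm. 27] -/
theorem cert131 (ψ : 𝓞 (CubicField (-46) 546 (-394)) →+* ZMod 131) : ∃ e : 𝓞 (CubicField (-46) 546 (-394)), ψ e = 0 ∧ Prime e := by
  refine cert_of_cases aeval_α ψ (fun t ht hF => ?_)
  have hroots : ∀ t : ZMod 131,
      t ^ 3 + (((-46) : ℤ) : ZMod 131) * t ^ 2 + ((546 : ℤ) : ZMod 131) * t + (((-394) : ℤ) : ZMod 131) = 0 → t = 25 := by
    decide +kernel
  obtain rfl := hroots t hF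
  exact ⟨lin aeval_α (-25) 1 0, by simp only [lin, map_add, map_mul, map_pow, map_intCast, ht]; decide,
      lin_prime_of_prime irreducible aeval_α finrank_eq (-25) 1 0 (n := (-131))
        (by norm_num [MonicCubic.normForm]) (by norm_num)⟩

/-- Certificate at `137`: every ring map `ψ : 𝓞 K → ℤ/137` kills a prime element
(`α ↦ 36`: `433 - 65 * α + 2 * α ^ 2` (norm `-137`)). [cite: Marcus2018, Ch. 3, Thm. 27] -/
theorem cert137 (ψ : 𝓞 (CubicField (-46) 546 (-394)) →+* ZMod 137) : ∃ e : 𝓞 (CubicField (-46) 546 (-394)), ψ e = 0 ∧ Prime e := by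
  refine cert_of_cases aeval_α ψ (fun t ht hF => ?_)
  have hroots : ∀ t : ZMod 137,
      t ^ 3 + (((-46) : ℤ) : ZMod 137) * t ^ 2 + ((546 : ℤ) : ZMod 137) * t + (((-394) : ℤ) : ZMod 137) = 0 → t = 36 := by
    decide +kernel
  obtain rfl := hroots t hF
  exact ⟨lin aeval_α 433 (-65) 2, by simp only [lin, map_add, map_mul, map_pow, map_intCast, ht]; decide,
      lin_prime_of_prime irreducible aeval_α finrank_eq 433 (-65) 2 (n := (-137))
        (by norm_num [MonicCubic.normForm]) (by norm_num)⟩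

/-- Certificate at `139`: `g` has no root mod `139`, so there is no ring map `𝓞 K → ℤ/139`. [folklore] -/
theorem cert139 (ψ : 𝓞 (CubicField (-46) 546 (-394)) →+* ZMod 139) : ∃ e : 𝓞 (CubicField (-46) 546 (-394)), ψ e = 0 ∧ Prime e :=
  cert_of_no_root aeval_α ψ (by decide +kernel)

end FieldR257876

end Summit.BirchSwinnertonDyer.BirchSwinnertonDyer.Rank2Observatory.TwoDescCubic

end
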